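import Summits.ResolutionOfSingularities.ResolutionOfSingularities.Theorems.FrobeniusLadderFRationalResolutionFixedStratumChains
import Literature.AlgebraicGeometry.Resolution.RegularLocalRingsProofs
import Mathlib.RingTheory.Localization.LocalizationLocalization
import HarnessLib

/-!
# Crux `FrobeniusLadder.FRationalResolution` (stmt-ResolutionOfSingularities-15317), line `redirect`,
# stub `stub_diagonalizableQuotientResolution` — **singularity propagates UP the torus-fixed stratum: if the fixed
# point over one stratum point below `𝔭` is singular, so is the fixed point over `𝔭`** (brick of design C3 = the
# rank-2 stratum layer of the non-isolated case, memo MEMO-15317-leafhand2-g10 §2 (L2): the surface-case test of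
# lineage 2 (`…VertexChartRegularity.not_isRegularLocalRing_fixedPrime_of_two_le`, valid at the GENERIC point of the
# stratum, where the stratum is zero-dimensional) is transported to every point of the stratum)

* `isRegularLocalRing_atPrime_of_le` — generic: for primes `𝔓' ⊆ 𝔓` of a commutative ring, if `C_𝔓` is a regular local
  ring then so is `C_{𝔓'}` (Serre, Matsumura Thm. 19.3 `isRegularLocalRing_localization_atPrime`, and
  `(C_𝔓)_{𝔓'C_𝔓} ≅ C_{𝔓'}`); `not_isRegularLocalRing_atPrime_of_le` — contrapositive;
* **`not_isRegularLocalRing_fixedPrime_of_stratum`** — for a chart algebra `C = A[χ(Q)]` over a log regular chart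
  ((D), (K), (S), (H)), a stratum prime `𝔭' ⊆ 𝔭` (`I(𝔭, φ) ⊆ 𝔭'`, `φ` log regular at `𝔭'`) and the fixed prime `𝔓`
  over `𝔭`: if every prime over `𝔭'` containing `χ(Q ∖ ℤF_𝔭)` is singular, then `C_𝔓` is singular
  (`…FixedStratumChains.exists_fixedPrime_le_of_stratum` puts such a prime inside `𝔓`).

Honest label: generic local algebra toward ONE leaf stub (no stub, crux or summit closed). No definitions, no named
facts, no sorry. [cite: Matsumura1987, Thm. 19.3] [cite: Kato1994, (7.3), (10.1)]
-/

noncomputable section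

-- single-problem summit: the doubled namespace component is forced
set_option linter.dupNamespace false

open IsLocalRing Literature.AlgebraicGeometry.Resolution Literature.AlgebraicGeometry.Resolution.LogChart
open Summit.ResolutionOfSingularities.ResolutionOfSingularities.Theorems.FRationalResolution.FixedStratumChains

namespace Summit.ResolutionOfSingularities.ResolutionOfSingularities.Theorems.FRationalResolution.FixedStratumSingular

universe u

/-! ### Regularity descends to smaller primes -/

/-- **Serre: `C_𝔓` regular ⇒ `C_{𝔓'}` regular for `𝔓' ⊆ 𝔓`.** [cite: Matsumura1987, Thm. 19.3] -/
theorem isRegularLocalRing_atPrime_of_le {C : Type u} [CommRing C] {𝔓' 𝔓 : Ideal C} [𝔓'.IsPrime] [𝔓.IsPrime]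
    (hle : 𝔓' ≤ 𝔓) (h : IsRegularLocalRing (Localization.AtPrime 𝔓)) :
    IsRegularLocalRing (Localization.AtPrime 𝔓') := by
  set R := Localization.AtPrime 𝔓 with hR
  have hdisj : Disjoint (𝔓.primeCompl : Set C) (𝔓' : Set C) :=
    Set.disjoint_left.mpr fun a ha h' => ha (hle h')
  haveI hp : (𝔓'.map (algebraMap C R)).IsPrime :=
    IsLocalization.isPrime_of_isPrime_disjoint 𝔓.primeCompl R 𝔓' inferInstance hdisj
  haveI : IsRegularLocalRing (Localization.AtPrime (𝔓'.map (algebraMap C R))) :=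
    isRegularLocalRing_localization_atPrime R _
  have hc : (𝔓'.map (algebraMap C R)).comap (algebraMap C R) = 𝔓' :=
    IsLocalization.under_map_of_isPrime_disjoint 𝔓.primeCompl R inferInstance hdisj
  -- `C_{𝔓'}` and `(C_𝔓)_{𝔓'}` are both localizations of `C` at `𝔓'`
  have hM : ((𝔓'.map (algebraMap C R)).comap (algebraMap C R)).primeCompl = 𝔓'.primeCompl := by
    ext x
    simp only [Ideal.mem_primeCompl_iff, hc]
  haveI : IsLocalization 𝔓'.primeCompl (Localization.AtPrime (𝔓'.map (algebraMap C R))) := by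
    rw [← hM]
    exact IsLocalization.isLocalization_atPrime_localization_atPrime 𝔓.primeCompl
      (𝔓'.map (algebraMap C R))
  exact IsRegularLocalRing.of_ringEquiv
    (IsLocalization.algEquiv 𝔓'.primeCompl (Localization.AtPrime (𝔓'.map (algebraMap C R)))
      (Localization.AtPrime 𝔓')).toRingEquiv

/-- Contrapositive: a singular `C_{𝔓'}` with `𝔓' ⊆ 𝔓` makes `C_𝔓` singular. [cite: Matsumura1987, Thm. 19.3] -/
theorem not_isRegularLocalRing_atPrime_of_le {C : Type u} [CommRing C] {𝔓' 𝔓 : Ideal C} [𝔓'.IsPrime]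
    [𝔓.IsPrime] (hle : 𝔓' ≤ 𝔓) (h : ¬ IsRegularLocalRing (Localization.AtPrime 𝔓')) :
    ¬ IsRegularLocalRing (Localization.AtPrime 𝔓) :=
  fun hR => h (isRegularLocalRing_atPrime_of_le hle hR)

/-! ### Transport along the fixed stratum -/

variable {A : Type u} [CommRing A] {n : ℕ} {P : AddSubmonoid (Fin n → ℤ)} {φ : Multiplicative P →* A}
  {𝔭 𝔭' : Ideal A} [𝔭.IsPrime] [𝔭'.IsPrime] {C : Type u} [CommRing C] [Algebra A C]
  {Q : AddSubmonoid (Fin n → ℤ)} {χ : Multiplicative Q →* C} {𝔓 : Ideal C} [𝔓.IsPrime]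

/-- **Singularity propagates up the fixed stratum.** Let `𝔭' ⊆ 𝔭` be a point of the stratum of `𝔭`
(`I(𝔭, φ) ⊆ 𝔭'`) at which `φ` is log regular, `C = A[χ(Q)]` a chart algebra with (D), (K), (S), (H), and `𝔓` a prime
over `𝔭` containing `χ(Q ∖ ℤF_𝔭)`. If EVERY prime of `C` over `𝔭'` containing `χ(Q ∖ ℤF_𝔭)` has a singular local
ring (e.g. the surface test at the generic point of a rank-2 stratum), then `C_𝔓` is singular.
[cite: Kato1994, (7.3), (10.1)] [cite: Matsumura1987, Thm. 19.3] -/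
theorem not_isRegularLocalRing_fixedPrime_of_stratum [IsNoetherianRing A] (hP : P.FG)
    (hsat : ∀ (v : Fin n → ℤ) (k : ℕ), 0 < k → k • v ∈ P → v ∈ P)
    (hle : 𝔭' ≤ 𝔭) (hI : ideal P φ 𝔭 ≤ 𝔭') (hreg' : IsLogRegularAt P φ 𝔭')
    (hPQ : P ≤ Q)
    (hχ : ∀ p : P, χ (Multiplicative.ofAdd ⟨(p : Fin n → ℤ), hPQ p.2⟩) =
      algebraMap A C (φ (Multiplicative.ofAdd p)))
    (hgen : Algebra.adjoin A (Set.range χ) = ⊤)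
    (hD : ∀ q ∈ Q, ∃ p ∈ P, q + p ∈ P)
    (hK : ∀ a : A, algebraMap A C a = 0 → ∃ p : P, φ (Multiplicative.ofAdd p) * a = 0)
    (hS : ∀ q₁ ∈ Q, ∀ q₂ ∈ Q, q₁ + q₂ ∈ Submodule.span ℤ (faceMonoid P φ 𝔭 : Set (Fin n → ℤ)) →
      q₁ ∈ Submodule.span ℤ (faceMonoid P φ 𝔭 : Set (Fin n → ℤ)))
    (hH : ∀ q ∈ Q, ∀ p ∈ P, q + p ∈ Submodule.span ℤ (faceMonoid P φ 𝔭 : Set (Fin n → ℤ)) →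
      q ∈ Submodule.span ℤ (faceMonoid P φ 𝔭 : Set (Fin n → ℤ)))
    (h𝔓 : 𝔓.comap (algebraMap A C) = 𝔭)
    (hq : ∀ q : Q, (q : Fin n → ℤ) ∉ Submodule.span ℤ (faceMonoid P φ 𝔭 : Set (Fin n → ℤ)) →
      χ (Multiplicative.ofAdd q) ∈ 𝔓)
    (hsing : ∀ (𝔓₁ : Ideal C) [𝔓₁.IsPrime], 𝔓₁.comap (algebraMap A C) = 𝔭' →
      (∀ q : Q, (q : Fin n → ℤ) ∉ Submodule.span ℤ (faceMonoid P φ 𝔭 : Set (Fin n → ℤ)) →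
        χ (Multiplicative.ofAdd q) ∈ 𝔓₁) → ¬ IsRegularLocalRing (Localization.AtPrime 𝔓₁)) :
    ¬ IsRegularLocalRing (Localization.AtPrime 𝔓) := by
  obtain ⟨𝔓₁, h𝔓₁, h𝔓₁A, h𝔓₁q, h𝔓₁le, -⟩ :=
    exists_fixedPrime_le_of_stratum hP hsat hle hI hreg' hPQ hχ hgen hD hK hS hH h𝔓 hq
  haveI := h𝔓₁
  exact not_isRegularLocalRing_atPrime_of_le h𝔓₁le
    (hsing 𝔓₁ h𝔓₁A fun q hqL => (h𝔓₁q q).2 hqL)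

end Summit.ResolutionOfSingularities.ResolutionOfSingularities.Theorems.FRationalResolution.FixedStratumSingular

end
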